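import Literature.AlgebraicGeometry.Modules.AffineStrata
import Literature.AlgebraicGeometry.Modules.ModuleCechComplex
import Literature.AlgebraicGeometry.Modules.PullbackSectionsBaseChange
import Literature.Algebra.Homology.OrderedCechSystemDevissage
import HarnessLib

/-!
# Base change of the module Čech complex to a prime stratum:
# `Γ(T_𝔭, 𝒪) ⊗_A Č•(𝓥, L) ≅ Č•(g⁻¹𝓥, g^*L)` on `g : P ×_K T_𝔭 ↪ P ×_K T` (EGA III 6.10.5; GW II 22.90)

For `T` affine with ring `A`, `X = P ×_K T`, `ρ = pr_T♯ : A → Γ(X, 𝒪)`, a finite family of AFFINE opens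
`𝓥` of `X` with affine intersections and a finite locally free `L`, and a prime `𝔭` of `A` with stratum
`g : Y = P ×_K T_𝔭 ↪ X` (`Modules/AffineStrata`), the affine base change of sections
(★ `Modules/PullbackSectionsBaseChange.exists_linearEquiv_tensor_sections_pullback`) gives `A`-linear
isomorphisms `B ⊗_A Γ(L, V_s) ≅ Γ(g^*L, g⁻¹V_s)` (`B = Γ(T_𝔭, 𝒪)`, an `A`-algebra through `ι♯`) natural
in non-empty `s`, hence (`Algebra/Homology/OrderedCechSystemMap`: `OrderedCech.sysComplexIsoNE`) an
isomorphism of ordered Čech complexes of `A`-modules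

  `Č(B ⊗_A (s ↦ Γ(L, V_s))) ≅ Č•(g⁻¹𝓥, g^*L)`  (`Modules.strataCechIso`),

together with `B ≃ₗ[A] A⧸𝔭` (`Modules.stratumLinearEquiv`): the input of the quotient step of the
dévissage (`Algebra/Homology/OrderedCechSystemDevissage`: `OrderedCech.StrataFinite`), assembled in
`Modules.strataFinite_of_finite_strata`. This is the termwise computation in the proof of Görtz–Wedhorn II,
Prop. 22.90 (flat base change of Čech complexes, here along the closed stratum after tensoring).
Everything is proved; no named facts. Mathlib searched (pin): `Algebra.TensorProduct.rid`,
`LinearEquiv.restrictScalars`, `IsScalarTower` transport (used); no Mathlib Čech base change for modules on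
schemes. Cell `hodgecm-mathlib`, M13 node N1 (1a-γ) (B-p10 (g8), cut/couriered by B-p15 (g8) per B-plan1
R140); generic, books 0.

## References

* U. Görtz, T. Wedhorn, *Algebraic Geometry II: Cohomology of Schemes* (2023),
  doi:10.1007/978-3-658-43031-3: Prop. 22.90 (p. 277), proof; Thm. 23.133, proof, Step (I) (p. 354).
  [GortzWedhorn2023]
* U. Görtz, T. Wedhorn, *Algebraic Geometry I: Schemes*, 2nd ed. (2020), Prop. 7.24 (2), Rem. 7.25.
  [GortzWedhorn2020]
* A. Grothendieck, EGA III₂ (Publ. Math. IHÉS 17, 1963), (6.10.5). [EGA3]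
* D. Mumford, *Abelian Varieties*, TIFR Studies in Mathematics 5 (1970), §5. [MumfordAV1970]
-/

universe u

open CategoryTheory CategoryTheory.Limits AlgebraicGeometry TopologicalSpace Opposite MonoidalCategory
open CartesianMonoidalCategory TensorProduct
open Literature.AlgebraicGeometry.Motives Literature.Algebra.Homology

set_option backward.isDefEq.respectTransparency false

noncomputable section

namespace Literature.AlgebraicGeometry.Modules

variable {K : Type u} [Field K] (P T : SchemeOver K) [IsAffine T.left] (𝔭 : PrimeSpectrum Γ(T.left, ⊤))
variable {ι : Type} (𝓥 : ι → (P ⊗ T).left.Opens) (L : (P ⊗ T).left.Modules)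

/-! ### Notation for the stratum -/

/-- The structure map `ρ = pr_T♯ : A = Γ(T, 𝒪) → Γ(P ×_K T, 𝒪)`. [folklore] [cite: GortzWedhorn2023, Prop. 22.90 (p. 277), proof] -/
abbrev baseToTotal : Γ(T.left, ⊤) →+* Γ((P ⊗ T).left, ⊤) := (snd P T).left.appTop.hom

/-- The closed immersion `g : P ×_K T_𝔭 ⟶ P ×_K T`. [folklore] [cite: GortzWedhorn2023, Prop. 22.90 (p. 277), proof] -/
abbrev strataMap : (P ⊗ stratum T 𝔭).left ⟶ (P ⊗ T).left := (P ◁ stratumι T 𝔭).left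

/-- The pulled-back family of opens `g⁻¹𝓥`. [folklore] [cite: GortzWedhorn2023, Prop. 22.90 (p. 277), proof] -/
abbrev strataCover : ι → (P ⊗ stratum T 𝔭).left.Opens := fun i => strataMap P T 𝔭 ⁻¹ᵁ 𝓥 i

/-- The pulled-back module `g^*L`. [folklore] [cite: GortzWedhorn2023, Prop. 22.90 (p. 277), proof] -/
abbrev strataMod : (P ⊗ stratum T 𝔭).left.Modules := (Scheme.Modules.pullback (strataMap P T 𝔭)).obj L

/-- `ι♯ : A → B = Γ(T_𝔭, 𝒪)` in the `appLE ⊤ ⊤` form used by the base-change lemma. [folklore] [cite: GortzWedhorn2023, Prop. 22.90 (p. 277), proof] -/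
abbrev baseToStratum : Γ(T.left, ⊤) →+* Γ((stratum T 𝔭).left, ⊤) :=
  ((stratumι T 𝔭).left.appLE ⊤ ⊤ le_top).hom

/-- `pr_{T_𝔭}♯ : B → Γ(P ×_K T_𝔭, 𝒪)`. [folklore] [cite: GortzWedhorn2023, Prop. 22.90 (p. 277), proof] -/
abbrev stratumToTotal : Γ((stratum T 𝔭).left, ⊤) →+* Γ((P ⊗ stratum T 𝔭).left, ⊤) :=
  (snd P (stratum T 𝔭)).left.appTop.hom

/-- The structure map `A → Γ(P ×_K T_𝔭, 𝒪)` through `B`. [folklore] [cite: GortzWedhorn2023, Prop. 22.90 (p. 277), proof] -/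
abbrev baseToStrataTotal : Γ(T.left, ⊤) →+* Γ((P ⊗ stratum T 𝔭).left, ⊤) :=
  (stratumToTotal P T 𝔭).comp (baseToStratum T 𝔭)

/-- `ι♯` in the two forms agree (`appLE ⊤ ⊤ _ = appTop`, cf. ★
`Motives.CartierDivisor.CechCover.appLE_top_top`, not imported to keep this file light). [folklore] [cite: GortzWedhorn2023, Prop. 22.90 (p. 277), proof] -/
theorem baseToStratum_apply (a : Γ(T.left, ⊤)) : baseToStratum T 𝔭 a = (stratumι T 𝔭).left.appTop a := by
  change ((stratumι T 𝔭).left.appLE ⊤ ⊤ le_top) a = _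
  rw [Scheme.Hom.appTop, Scheme.Hom.app_eq_appLE]
  rfl

/-! ### `B = Γ(T_𝔭, 𝒪)` as an `A`-module; `B ≃ₗ[A] A⧸𝔭` -/

/-- The `A`-algebra structure on `B = Γ(T_𝔭, 𝒪)` through `ι♯` (a reducible `def`, used with `letI`). [folklore] [cite: GortzWedhorn2023, Prop. 22.90 (p. 277), proof] -/
@[reducible] def stratumAlgebra : Algebra Γ(T.left, ⊤) Γ((stratum T 𝔭).left, ⊤) := (baseToStratum T 𝔭).toAlgebra

/-- **`Γ(T_𝔭, 𝒪) ≃ₗ[A] A⧸𝔭`** (the ring isomorphism `Scheme.ΓSpecIso`, `A`-linear because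
`ι♯ a ↦ a mod 𝔭`). [folklore] [cite: GortzWedhorn2023, Prop. 22.90 (p. 277), proof] -/
def stratumLinearEquiv :
    letI := stratumAlgebra T 𝔭
    Γ((stratum T 𝔭).left, ⊤) ≃ₗ[Γ(T.left, ⊤)] (Γ(T.left, ⊤) ⧸ 𝔭.asIdeal) :=
  letI := stratumAlgebra T 𝔭
  { (stratumRingIso T 𝔭).commRingCatIsoToRingEquiv.toAddEquiv with
    map_smul' := fun a x => by
      change (stratumRingIso T 𝔭).hom (baseToStratum T 𝔭 a * x) = Ideal.Quotient.mk 𝔭.asIdeal a * (stratumRingIso T 𝔭).hom x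
      rw [map_mul, baseToStratum_apply, stratumRingIso_hom_appTop] }

/-! ### The termwise base change on non-empty members -/

section Termwise

variable [LinearOrder ι]
variable (hV : ∀ s : Finset ι, s.Nonempty → IsAffineOpen (cechOpen 𝓥 s)) (hL : IsFiniteLocallyFree L)

omit [LinearOrder ι] in
/-- `g⁻¹(V_s) = (g⁻¹𝓥)_s`. [folklore] [cite: GortzWedhorn2023, Prop. 22.90 (p. 277), proof] -/
theorem cechOpen_strataCover (s : Finset ι) :
    cechOpen (strataCover P T 𝔭 𝓥) s = strataMap P T 𝔭 ⁻¹ᵁ cechOpen 𝓥 s :=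
  (preimage_cechOpen 𝓥 (strataMap P T 𝔭) s).symm

omit [LinearOrder ι] in
/-- The equation `U_Y = g⁻¹U_X ∩ pr⁻¹⊤` of the base-change lemma for the `V_s`. [folklore] [cite: GortzWedhorn2023, Prop. 22.90 (p. 277), proof] -/
theorem cechOpen_strataCover_eq (s : Finset ι) :
    cechOpen (strataCover P T 𝔭 𝓥) s =
      strataMap P T 𝔭 ⁻¹ᵁ cechOpen 𝓥 s ⊓ (snd P (stratum T 𝔭)).left ⁻¹ᵁ ⊤ := by
  rw [cechOpen_strataCover, Scheme.Hom.preimage_top, inf_top_eq]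

include hV hL in
omit [LinearOrder ι] in
/-- **`B ⊗_A Γ(L, V_s) ≃ₗ[B] Γ(g^*L, g⁻¹V_s)`, `b ⊗ m ↦ b · η(m)|`** (★ (1a-β)
`exists_linearEquiv_tensor_sections_pullback` for the cartesian square over `T_𝔭 ↪ T`, ★
`isPullback_whiskerLeft_snd`), with the module structures of `Modules/ModuleCechComplex` (`SecMod`).
[cite: GortzWedhorn2020, Prop. 7.24 (2) and Rem. 7.25] -/
theorem exists_stratum_tensor_equiv (s : Finset ι) (hs : s.Nonempty) :
    letI := stratumAlgebra T 𝔭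
    ∃ e : Γ((stratum T 𝔭).left, ⊤) ⊗[Γ(T.left, ⊤)] SecMod L (baseToTotal P T) (cechOpen 𝓥 s) ≃ₗ[Γ((stratum T 𝔭).left, ⊤)]
        SecMod (strataMod P T 𝔭 L) (stratumToTotal P T 𝔭) (cechOpen (strataCover P T 𝔭 𝓥) s),
      ∀ (b : Γ((stratum T 𝔭).left, ⊤)) (m : SecMod L (baseToTotal P T) (cechOpen 𝓥 s)),
        e (b ⊗ₜ m) = b • SecMod.mk (unitSectionLE (strataMap P T 𝔭) L
          (le_preimage_left_of_eq_inf (cechOpen_strataCover_eq P T 𝔭 𝓥 s)) (SecMod.val m)) := by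
  letI := stratumAlgebra T 𝔭
  letI : Module Γ(T.left, ⊤) Γ(L, cechOpen 𝓥 s) := SecMod.instModule L (baseToTotal P T) (cechOpen 𝓥 s)
  letI : Module Γ((stratum T 𝔭).left, ⊤) Γ(strataMod P T 𝔭 L, cechOpen (strataCover P T 𝔭 𝓥) s) :=
    SecMod.instModule (strataMod P T 𝔭 L) (stratumToTotal P T 𝔭) (cechOpen (strataCover P T 𝔭 𝓥) s)
  haveI := hL.isVectorBundle.1
  exact exists_linearEquiv_tensor_sections_pullback (isPullback_whiskerLeft_snd P (stratumι T 𝔭))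
    (isAffineOpen_top T.left) (isAffineOpen_top (stratum T 𝔭).left) (hV s hs) le_top
    (fun x _ => trivial) (cechOpen_strataCover_eq P T 𝔭 𝓥 s) L (IsAffineLocalizing.of_isQuasicoherent L)
    rfl (fun r m => rfl) (fun t n => rfl)

end Termwise

/-! ### The `A`-linear base-change isomorphisms and their naturality -/

section Assembly

variable [LinearOrder ι]
variable (hV : ∀ s : Finset ι, s.Nonempty → IsAffineOpen (cechOpen 𝓥 s)) (hL : IsFiniteLocallyFree L)

/-- The `B`-linear base change `B ⊗_A Γ(L, V_s) ≃ₗ[B] Γ(g^*L, g⁻¹V_s)` on a non-empty `s` (a choice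
of the isomorphism of `exists_stratum_tensor_equiv`). [cite: GortzWedhorn2020, Prop. 7.24 (2)] -/
def strataTensorEquivB (s : Finset ι) (hs : s.Nonempty) :
    letI := stratumAlgebra T 𝔭
    Γ((stratum T 𝔭).left, ⊤) ⊗[Γ(T.left, ⊤)] SecMod L (baseToTotal P T) (cechOpen 𝓥 s) ≃ₗ[Γ((stratum T 𝔭).left, ⊤)]
      SecMod (strataMod P T 𝔭 L) (stratumToTotal P T 𝔭) (cechOpen (strataCover P T 𝔭 𝓥) s) :=
  letI := stratumAlgebra T 𝔭
  Classical.choose (exists_stratum_tensor_equiv P T 𝔭 𝓥 L hV hL s hs)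

omit [LinearOrder ι] in
/-- The `B`-linear base change on pure tensors: `b ⊗ m ↦ b · η(m)|`. [folklore] [cite: GortzWedhorn2023, Prop. 22.90 (p. 277), proof] -/
theorem strataTensorEquivB_tmul (s : Finset ι) (hs : s.Nonempty)
    (b : Γ((stratum T 𝔭).left, ⊤)) (m : SecMod L (baseToTotal P T) (cechOpen 𝓥 s)) :
    letI := stratumAlgebra T 𝔭
    strataTensorEquivB P T 𝔭 𝓥 L hV hL s hs (b ⊗ₜ m) =
      b • SecMod.mk (ρ := stratumToTotal P T 𝔭) (unitSectionLE (strataMap P T 𝔭) L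
        (le_preimage_left_of_eq_inf (cechOpen_strataCover_eq P T 𝔭 𝓥 s)) (SecMod.val m)) :=
  Classical.choose_spec (exists_stratum_tensor_equiv P T 𝔭 𝓥 L hV hL s hs) b m

/-- **The `A`-linear base change `B ⊗_A Γ(L, V_s) ≃ₗ[A] Γ(g^*L, g⁻¹V_s)`** on a non-empty `s` (the
`B`-linear isomorphism `strataTensorEquivB` with scalars restricted along `ι♯ : A → B`; the target
carries the `A`-module structure through `A → B → Γ(P ×_K T_𝔭, 𝒪)`). [cite: GortzWedhorn2020, Prop. 7.24 (2)] -/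
def strataTensorEquiv (s : Finset ι) (hs : s.Nonempty) :
    letI := stratumAlgebra T 𝔭
    Γ((stratum T 𝔭).left, ⊤) ⊗[Γ(T.left, ⊤)] SecMod L (baseToTotal P T) (cechOpen 𝓥 s) ≃ₗ[Γ(T.left, ⊤)]
      SecMod (strataMod P T 𝔭 L) (baseToStrataTotal P T 𝔭) (cechOpen (strataCover P T 𝔭 𝓥) s) :=
  letI := stratumAlgebra T 𝔭
  let e := strataTensorEquivB P T 𝔭 𝓥 L hV hL s hs
  { toFun := e
    invFun := e.symm
    map_add' := e.map_add
    left_inv := e.left_inv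
    right_inv := e.right_inv
    map_smul' := fun a x => by
      rw [← IsScalarTower.algebraMap_smul (Γ((stratum T 𝔭).left, ⊤)) a x, LinearEquiv.map_smul]
      rfl }

omit [LinearOrder ι] in
/-- The `A`-linear and the `B`-linear base changes have the same underlying map. [folklore] [cite: GortzWedhorn2023, Prop. 22.90 (p. 277), proof] -/
theorem strataTensorEquiv_apply (s : Finset ι) (hs : s.Nonempty)
    (x : letI := stratumAlgebra T 𝔭
      Γ((stratum T 𝔭).left, ⊤) ⊗[Γ(T.left, ⊤)] SecMod L (baseToTotal P T) (cechOpen 𝓥 s)) :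
    strataTensorEquiv P T 𝔭 𝓥 L hV hL s hs x = strataTensorEquivB P T 𝔭 𝓥 L hV hL s hs x := rfl

omit [LinearOrder ι] in
/-- **Naturality of the base change in the open** (`s ⊆ t` non-empty): restriction after base change is
base change after `1 ⊗ res` (★ `map_tensor_sections_pullback_natural`). [cite: GortzWedhorn2020, Prop. 7.24 (2) and Rem. 7.25] -/
theorem strataTensorEquiv_natural (s t : Finset ι) (hs : s.Nonempty) (ht : t.Nonempty) (h : s ⊆ t)
    (x : letI := stratumAlgebra T 𝔭
      Γ((stratum T 𝔭).left, ⊤) ⊗[Γ(T.left, ⊤)] SecMod L (baseToTotal P T) (cechOpen 𝓥 s)) :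
    letI := stratumAlgebra T 𝔭
    strataTensorEquiv P T 𝔭 𝓥 L hV hL t ht
        (((OrderedCech.lTensorSys Γ((stratum T 𝔭).left, ⊤) (sectionsSystem 𝓥 L (baseToTotal P T))).map
          (homOfLE h)).hom x) =
      ((sectionsSystem (strataCover P T 𝔭 𝓥) (strataMod P T 𝔭 L) (baseToStrataTotal P T 𝔭)).map
        (homOfLE h)).hom (strataTensorEquiv P T 𝔭 𝓥 L hV hL s hs x) := by
  letI := stratumAlgebra T 𝔭
  letI : Module Γ(T.left, ⊤) Γ(L, cechOpen 𝓥 s) := SecMod.instModule L (baseToTotal P T) (cechOpen 𝓥 s)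
  letI : Module Γ(T.left, ⊤) Γ(L, cechOpen 𝓥 t) := SecMod.instModule L (baseToTotal P T) (cechOpen 𝓥 t)
  letI : Module Γ((stratum T 𝔭).left, ⊤) Γ(strataMod P T 𝔭 L, cechOpen (strataCover P T 𝔭 𝓥) s) :=
    SecMod.instModule (strataMod P T 𝔭 L) (stratumToTotal P T 𝔭) (cechOpen (strataCover P T 𝔭 𝓥) s)
  letI : Module Γ((stratum T 𝔭).left, ⊤) Γ(strataMod P T 𝔭 L, cechOpen (strataCover P T 𝔭 𝓥) t) :=
    SecMod.instModule (strataMod P T 𝔭 L) (stratumToTotal P T 𝔭) (cechOpen (strataCover P T 𝔭 𝓥) t)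
  have key := map_tensor_sections_pullback_natural (iY := (snd P (stratum T 𝔭)).left)
    (cechOpen_strataCover_eq P T 𝔭 𝓥 s) (cechOpen_strataCover_eq P T 𝔭 𝓥 t) (cechOpen_anti 𝓥 h)
    L (fun _ _ => rfl) (fun _ _ => rfl)
    (SecMod.res L (baseToTotal P T) (cechOpen_anti 𝓥 h)) (fun _ => rfl)
    (strataTensorEquivB P T 𝔭 𝓥 L hV hL s hs).toLinearMap (strataTensorEquivB_tmul P T 𝔭 𝓥 L hV hL s hs)
    (strataTensorEquivB P T 𝔭 𝓥 L hV hL t ht).toLinearMap (strataTensorEquivB_tmul P T 𝔭 𝓥 L hV hL t ht) x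
  exact key.symm

/-- **The base change of the module Čech complex to the stratum**: an isomorphism of ordered Čech
complexes of `A`-modules `Č(B ⊗_A (s ↦ Γ(L, V_s))) ≅ Č•(g⁻¹𝓥, g^*L)` (F1 `sysComplexIsoNE` on the
termwise base changes; EGA III 6.10.5 / Görtz–Wedhorn II, proof of Prop. 22.90).
[cite: GortzWedhorn2023, Prop. 22.90 (p. 277), proof] -/
def strataCechIso :
    letI := stratumAlgebra T 𝔭
    OrderedCech.sysComplex (OrderedCech.lTensorSys Γ((stratum T 𝔭).left, ⊤) (sectionsSystem 𝓥 L (baseToTotal P T))) ≅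
      cechComplex (strataCover P T 𝔭 𝓥) (strataMod P T 𝔭 L) (baseToStrataTotal P T 𝔭) :=
  letI := stratumAlgebra T 𝔭
  OrderedCech.sysComplexIsoNE (fun s hs => strataTensorEquiv P T 𝔭 𝓥 L hV hL s hs)
    (fun s t hs ht h x => strataTensorEquiv_natural P T 𝔭 𝓥 L hV hL s t hs ht h x)

include hV hL in
/-- **The quotient step of the dévissage, geometric form**: if the module Čech cohomology of `g^*L` on
the (integral) stratum `P ×_K T_𝔭` is finitely generated over `A`, then so is that of the system
`A⧸𝔭 ⊗_A (s ↦ Γ(L, V_s))`. [cite: GortzWedhorn2023, Thm. 23.133, proof, Step (I) (p. 354)] -/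
theorem module_finite_homology_lTensorSys_quotient
    (hfin : ∀ i, Module.Finite Γ(T.left, ⊤)
      ((cechComplex (strataCover P T 𝔭 𝓥) (strataMod P T 𝔭 L) (baseToStrataTotal P T 𝔭)).homology i))
    (i : ℤ) :
    Module.Finite Γ(T.left, ⊤) ((OrderedCech.sysComplex
      (OrderedCech.lTensorSys (Γ(T.left, ⊤) ⧸ 𝔭.asIdeal) (sectionsSystem 𝓥 L (baseToTotal P T)))).homology i) := by
  letI := stratumAlgebra T 𝔭
  have h₁ := OrderedCech.module_finite_homology_of_iso (strataCechIso P T 𝔭 𝓥 L hV hL).symm i (hfin i)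
  exact OrderedCech.module_finite_homology_of_iso
    (OrderedCech.sysComplexMapIso (OrderedCech.lTensorSysIso (sectionsSystem 𝓥 L (baseToTotal P T))
      (stratumLinearEquiv T 𝔭))) i h₁

end Assembly

end Literature.AlgebraicGeometry.Modules

end


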